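import Literature.NumberTheory.Automorphic.Liu2021.AppendixC.EtaleHeckeDatumOfTranslates
import HarnessLib

/-!
# [Liu 2021, §4.2] an element whose Hecke translates are identities acts trivially on `H¹_ét(A_∞)`

Topic `NumberTheory/Automorphic/Liu2021/AppendixC`; namespace `Literature.NumberTheory.Automorphic.Liu2021.AppendixC`
(sequel of `EtaleHeckeDatumOfTranslates.lean`: `Sec42Data.exists_eq_toTower`, `EtaleHeckeDatum.IsInducedBy`).
THEOREMS ONLY; no definition, no named fact, no instance, no `sorry`.

For a tower datum `C : Sec42Data P5 isotropicAt`, an étale Hecke datum `X : C.EtaleHeckeDatum ℓ` INDUCED by a family of Hecke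
translates `T : C.HeckeTranslates` (`X.IsInducedBy T`: `z · [φ]_K = [ᵗV_ℓ(Alb(T_z)) φ]_K`), and an element `z ∈ C.G` admissible at
every level (`C5.HeckeLE z K K` for all `K`, e.g. a CENTRAL element) all of whose translates `T_z : X_K ⟶ X_K` are the identity:
* `EtaleHeckeDatum.rhoEt_eq_self_of_isInducedBy_of_tr_eq_id` — `z` acts trivially on `H¹_ét(A_∞)` (`Alb(𝟙) = 𝟙` and the level
  classes `[·]_K` exhaust the colimit);
* `EtaleHeckeDatum.rhoEt_eq_one_of_isInducedBy_of_tr_eq_id` — the same as `X.rhoEt z = 1`.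
This is the pattern of `etHeckeRep_toTower_of_mem` (translates by elements of the LEVEL are `𝟙`) for the CENTRE: combined with
«the rational centre acts trivially on `Sh_K`» ([Milne2005ShimuraVarieties] §5 p. 57) it is the clause that makes the central
characters occurring in `H¹_ét` of a Shimura curve tower automorphic ([Liu2021] proof of Thm. 4.15, l. 2199–2212).

## References
* [Liu2021] Y. Liu, Camb. J. Math. 9 (2021): §4.2 «Albanese of unitary Shimura varieties» (FJcycle.tex l. 2074, Hecke
  correspondences; l. 2160, the induced action on `H¹_ét`; print pp. 49–50), proof of Thm. 4.15 (l. 2199–2212; print pp. 50–51).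
* [Milne2005ShimuraVarieties] J. S. Milne, *Introduction to Shimura varieties* (2005/2017), §5 p. 57.
-/

set_option autoImplicit false

noncomputable section

open NumberField

namespace Literature.NumberTheory.Automorphic.Liu2021.AppendixC

open CategoryTheory
open Literature.AlgebraicGeometry.Motives (AbelianVariety)
open Literature.AlgebraicGeometry.Motives.AbelianVariety (rationalTateModuleMap rationalTateModuleMap_id)

variable {F E : Type} [Field F] [NumberField F] [IsTotallyReal F] [Field E] [NumberField E] [Algebra F E]
  [IsTotallyComplex E] [Algebra.IsQuadraticExtension F E]
variable {P5 : PropC5Data F E} {isotropicAt : ℕ → Prop} {C : Sec42Data P5 isotropicAt} {ℓ : ℕ} [Fact ℓ.Prime]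

/-- **If the Hecke action on `H¹_ét(A_∞)` is induced by translates `T` and every translate `T_z : X_K → X_K` of an element `z`
(admissible at every level, e.g. central) is the identity, then `z` acts trivially on `H¹_ét(A_∞)`** (`z · [φ]_K = [ᵗV_ℓ(Alb(T_z)) φ]_K`,
`Alb(𝟙) = 𝟙`, and the `[·]_K` exhaust the colimit — ★ `exists_eq_toTower`).  The pattern of ★ `etHecke_toTower_of_mem` for the
CENTRE instead of the level. [cite: Liu2021, §4.2 (FJcycle.tex l. 2074 and l. 2160; print pp. 49–50)] [cite: Milne2005ShimuraVarieties, §5 p. 57] -/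
theorem EtaleHeckeDatum.rhoEt_eq_self_of_isInducedBy_of_tr_eq_id {X : C.EtaleHeckeDatum ℓ} {T : C.HeckeTranslates}
    (hX : X.IsInducedBy T) {z : C.G} (hz : ∀ K : C5.SmallLevel C.S.K₀, C5.HeckeLE z K K)
    (htr : ∀ K : C5.SmallLevel C.S.K₀, T.tr z K K (hz K) = 𝟙 (C.X K)) (x : C.etaleH1Tower ℓ) :
    X.rhoEt z x = x := by
  obtain ⟨K, φ, rfl⟩ := Sec42Data.exists_eq_toTower C ℓ x
  have halb : T.albTr z K K (hz K) = 𝟙 (C.A K) := by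
    rw [Sec42Data.HeckeTranslates.albTr, htr K]
    exact Albanese.map_id _
  rw [hX z K K (hz K) φ, halb, rationalTateModuleMap_id, LinearMap.dualMap_id, LinearMap.id_apply]

/-- the same as an identity of operators: `X.rhoEt z = 1`. [cite: Liu2021, §4.2 (FJcycle.tex l. 2160; print pp. 49–50)] -/
theorem EtaleHeckeDatum.rhoEt_eq_one_of_isInducedBy_of_tr_eq_id {X : C.EtaleHeckeDatum ℓ} {T : C.HeckeTranslates}
    (hX : X.IsInducedBy T) {z : C.G} (hz : ∀ K : C5.SmallLevel C.S.K₀, C5.HeckeLE z K K)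
    (htr : ∀ K : C5.SmallLevel C.S.K₀, T.tr z K K (hz K) = 𝟙 (C.X K)) : X.rhoEt z = 1 :=
  LinearMap.ext fun x => EtaleHeckeDatum.rhoEt_eq_self_of_isInducedBy_of_tr_eq_id hX hz htr x

end Literature.NumberTheory.Automorphic.Liu2021.AppendixC

end
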